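import Literature.Computability.AlgebraicComplexity.DeterminantalComplexityProofs
import Summits.ValiantsHypothesis.ValiantsHypothesis.Theses.DetQP
import Summits.ValiantsHypothesis.ValiantsHypothesis.Theorems.DetQPDetqpSuperquadraticLinearHomogenisation
import Summits.ValiantsHypothesis.ValiantsHypothesis.Theorems.DetQPDetqpSuperquadraticStubKrylovMRFloor

/-!
# Crux `DetQP.DetqpSuperquadratic` (stmt-ValiantsHypothesis-0318), line `linear-homogenisation-transfer` —
stub `stub_cruxOfKrylovWidth`: the reduction "S3 ⇒ crux"

The line reduces the crux `dc(per_n) ≥ n^(2+ε)` (for all large `n`) to ONE open width statement S3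
about KRYLOV NORMAL FORMS of the permanent: homogeneous linear `ρ, γ ∈ (S¹)^w`, `L ∈ M_w(S¹)`
(`S = ℂ[x_ij]`) with (A3) `ρᵀ L^(n−2) γ = per_n`, (A2) `ρᵀ Lʲ γ = 0` for `j < n − 2`,
(A4) `per_n ∣ ρᵀ Lʲ γ` for all `j`, handed in addition the power-trace twin
`HasPowTraceRepr ℂ per_n n (2w + 1)` and the Mignon–Ressayre floor `n² ≤ 2w + 4` as free hypotheses,
must have super-quadratic width `n^(2+ε) ≤ w`.

This file lands the reduction itself:

* `stub_cruxOfKrylovWidth` : S3 → `DetqpSuperquadratic`.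

**Proof.**  From S3 take `ε, n₀`; for `n ≥ max n₀ 3` the determinantal complexity `m = dc(per_n)` is
attained (`hasDetRepr_determinantalComplexity_holds`) and `≥ 1`
(`one_le_determinantalComplexity_perPoly`), so `m = w + 1`.  The landed stubs S1a/S1b put the attained
expression in Krylov normal form of width `w` (`hasKrylov_of_hasDetRepr_perPoly`), S2 supplies the
power-trace twin of size `2w + 1` (`hasPowTraceRepr_of_hasDetRepr_perPoly`), S2½ the floor
`n² ≤ 2w + 4` (`stub_krylovMRFloor`), and S3 gives `n^(2+ε) ≤ w ≤ w + 1 = m`.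
-/

noncomputable section

-- `Summit.ValiantsHypothesis.ValiantsHypothesis.…` is the tree's mandated single-conjunct layout (Sub = Summit).
set_option linter.dupNamespace false

namespace Summit.ValiantsHypothesis.ValiantsHypothesis.Theorems.DetQPDetqpSuperquadratic

open MvPolynomial Matrix
open Literature.Computability.AlgebraicComplexity
open Literature.Barriers.ValiantsHypothesis (HasPowTraceRepr powTraceComplexity)

/-- **Registered sub-goal `stub_cruxOfKrylovWidth` — the reduction "S3 ⇒ crux".**  If every Krylov
normal form of `per_n` (homogeneous linear `ρ, γ, L` of width `w` with `ρᵀ L^(n−2) γ = per_n`,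
`ρᵀ Lʲ γ = 0` for `j < n − 2`, `per_n ∣ ρᵀ Lʲ γ` for all `j`), given moreover a power-trace twin of
size `2w + 1` and the floor `n² ≤ 2w + 4`, has width `w ≥ n^(2+ε)` for all large `n`, then
`dc(per_n) ≥ n^(2+ε)` for all large `n` (`DetQP.DetqpSuperquadratic`): the attained determinantal
expression of size `dc(per_n) = w + 1` is put in Krylov normal form of width `w` by the landed stubs
S1a/S1b (`hasKrylov_of_hasDetRepr_perPoly`), its twin and floor come from S2
(`hasPowTraceRepr_of_hasDetRepr_perPoly`) and S2½ (`stub_krylovMRFloor`). [folklore] -/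
theorem stub_cruxOfKrylovWidth :
    (∃ ε : ℝ, 0 < ε ∧ ∃ n₀ : ℕ, ∀ n ≥ n₀, ∀ (w : ℕ) (ρ γ : Fin w → MvPolynomial (Fin n × Fin n) ℂ)
      (L : Matrix (Fin w) (Fin w) (MvPolynomial (Fin n × Fin n) ℂ)),
      (∀ i, (ρ i).IsHomogeneous 1) → (∀ i, (γ i).IsHomogeneous 1) → (∀ i j, (L i j).IsHomogeneous 1) →
      ρ ⬝ᵥ ((L ^ (n - 2)) *ᵥ γ) = perPoly (Fin n) ℂ →
      (∀ j : ℕ, j < n - 2 → ρ ⬝ᵥ ((L ^ j) *ᵥ γ) = 0) →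
      (∀ j : ℕ, perPoly (Fin n) ℂ ∣ ρ ⬝ᵥ ((L ^ j) *ᵥ γ)) →
      HasPowTraceRepr ℂ (perPoly (Fin n) ℂ) n (2 * w + 1) → n ^ 2 ≤ 2 * w + 4 →
      (n : ℝ) ^ (2 + ε) ≤ (w : ℝ)) →
    Summit.ValiantsHypothesis.ValiantsHypothesis.Theses.DetQP.DetqpSuperquadratic := by
  intro hS3
  obtain ⟨ε, hε, n₀, H⟩ := hS3
  refine ⟨ε, hε, max n₀ 3, fun n hn => ?_⟩
  have hn₀ : n₀ ≤ n := le_trans (le_max_left _ _) hn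
  have hn3 : 3 ≤ n := le_trans (le_max_right _ _) hn
  -- the determinantal complexity is attained and positive: `dc(per_n) = w + 1`
  have hatt : HasDetRepr (perPoly (Fin n) ℂ) (determinantalComplexity (perPoly (Fin n) ℂ)) :=
    hasDetRepr_determinantalComplexity_holds _
  have hpos : 1 ≤ determinantalComplexity (perPoly (Fin n) ℂ) :=
    one_le_determinantalComplexity_perPoly (by omega)
  obtain ⟨w, hw⟩ : ∃ w : ℕ, determinantalComplexity (perPoly (Fin n) ℂ) = w + 1 :=
    ⟨determinantalComplexity (perPoly (Fin n) ℂ) - 1, by omega⟩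
  rw [hw] at hatt
  -- Krylov normal form of width `w` (S1a + S1b), its power-trace twin (S2) and the MR floor (S2½)
  obtain ⟨ρ, γ, L, hρ, hγ, hL, hA3, hA2, hA4⟩ := hasKrylov_of_hasDetRepr_perPoly hn3 hatt
  have hT : HasPowTraceRepr ℂ (perPoly (Fin n) ℂ) n (2 * w + 1) :=
    hasPowTraceRepr_of_hasDetRepr_perPoly hn3 hatt
  have hfloor : n ^ 2 ≤ 2 * w + 4 := stub_krylovMRFloor n w ρ γ L hn3 hρ hγ hL hA3 hA2 hA4
  -- S3: `n^(2+ε) ≤ w ≤ w + 1 = dc(per_n)`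
  have hle : (n : ℝ) ^ (2 + ε) ≤ (w : ℝ) := H n hn₀ w ρ γ L hρ hγ hL hA3 hA2 hA4 hT hfloor
  have hw' : (w : ℝ) ≤ (determinantalComplexity (perPoly (Fin n) ℂ) : ℝ) := by
    rw [hw]
    exact_mod_cast Nat.le_succ w
  exact hle.trans hw'

end Summit.ValiantsHypothesis.ValiantsHypothesis.Theorems.DetQPDetqpSuperquadratic
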